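import Literature.IUT.HodgeArakelov.ThetaEnvDataRecordProp31
import Literature.IUT.HodgeArakelov.BadPrimeGaussianMonoidsGenuineRecordAtModelTateRecord
import HarnessLib

/-!
# [IUTchII] Prop 3.1 (i)(ii): the PACKAGED statement structure `Prop31Statements` AT THE GENUINE `θ_env` RECORD OF THE
# TATE MODEL `modelTate p` — print-faithful OUTER inversion family through ONE pointed inversion (proof-only; K-L6)

S. Mochizuki, *Inter-universal Teichmüller theory II*, kurims manuscript (Dec. 2020), §3 Prop. 3.1 (i) p. 87 l. 47–53
(«`ι` ranges over the inversion automorphisms of Proposition 2.2, (i) … equipped with a natural conjugation action by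
`Π_X(M^Θ_*)` … splittings up to torsion»), (ii) p. 88; Rmk. 1.4.1 (ii) p. 28 (`ι_Ÿ` is an OUTER automorphism, unique up
to `l·ℤ`-conjugacy and `Gal(Ÿ̲̲/Y̲̲)`) [cite: Mochizuki2012, Prop 3.1 (i) p.87]. Claim key `Mochizuki2012` (D-0012,
DISPUTED): nothing of the series is asserted; composition of LANDED theorems over the cell's OWN model objects; no side
taken on [IUTchIII] Cor. 3.12. PROOF-ONLY companion (abc-iut cell, layer L6, seat abc-iut-w5-d031 gen 11; L-F row LF6-02 =
FACT-LIST row F-2567 `TemperedThetaMonoids.Prop31Statements`, «schema; instance forms are the content»; cone node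
IUTchII:Prop3.1(i), K-L6 instance of record). NO definition, NO `Prop` fact, NO instance; nothing landed is edited.

WHAT. abc-iut-w5-d072's K-L6 instance of record `EtaleLevels.splitting_toRecord_padic_of_eval_modelTate` (p460881/p461404)
proves the «splittings up to torsion» clause of [IUTchII] Prop. 3.1 (i) at the genuine `θ_env` record of `modelTate p`
(Galois factor `inr`, class `η̈♯ = etaDdχq`, `X̲̲ := Huuχq`, root cocycle `rootLift`, cyclotome family of a tower `τ`, empty
cusp labelling, `l` an odd prime with `4l ∣ p − 1`) AT ONE LABEL `i₀` of an ARBITRARY inversion family `iota` whose `i₀`-th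
action is the transport `pairRhoLim` of the pointed inversion PAIR `(inversionAlpha C ι hι, ι^Θ)`, `ι := inversionχq`. THIS
FILE takes the PRINT-FAITHFUL family of record — abc-iut-w4-d019's OUTER family `thetaEnvRecordOuterKummer … e₀ c hA hfi O`
(`ThetaEnvDataRecordModelOuter.lean`): the inversions are the `Π^tp_{X̲̲}`-conjugates `conj_g ∘ e₀ ∘ conj_g⁻¹` of the ONE action
`e₀ := pairRhoLim …` — whose label-`1` member IS `e₀` (§1, `h1LimConjEquiv_one_conj_outer`: conjugation by `1` is the
identity), and composes with the label transport of `ThetaEnvDataRecordProp31.lean` (p492714,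
`prop31Statements_thetaEnvRecordOuterKummer_of_splitting_at`): **`prop31Statements_thetaEnvRecordOuterKummer_modelTate`**
— the WHOLE `Prop31Statements` (conjugation action permuting `{Ψ^ι_env}_ι`; splittings up to torsion at EVERY label;
`Ψ_cns` conjugation-stable) at that record. RESIDUAL (every binder after the `let`s, BY NAME): {(H1) `PiYddCharacteristic C`
(F-2633 AT THE INSTANCE), the tower `τ` (DATA), `Π^tp_{X̲̲}`-stability of the constant monoid `O` (`hOst`), and the
[IUTchII] Cor. 3.5 (K)/(E) DATA exactly as in p461404: constants `c`/`c₀` on `ℚ̄_pˣ` bijective with `μ ⊆ O`, ONE evaluation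
section `s₀` with `hact` and finite-index image, a base point `θ ∈ θ^{1}_env` with evaluation `R₀ θ = κ₀ q`, `q` a
non-unit} — NO ι-datum binder, NO class-level binder, NO §1-fact binder, NO inversion-family binder.

HONEST LABEL. `modelTate` is a SEMI-SYNTHETIC model of the typed [EtTh] §1 interface (not the tempered `π₁` of a curve,
no theta FUNCTION): binder-discharge / joint-satisfiability evidence for the typed interface only; an instance at OUR model
is not the print universal closure (refuted as a schema). Nothing of [IUTchII]/[EtTh] is asserted; no side is taken on
[IUTchIII] Cor. 3.12 nor on which lift of the inversion print's `ι` denotes; typed ≠ proved; instantiated ≠ endorsed;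
nothing here bears on whether abc is proved or refuted. [claim: Mochizuki2012, status: disputed]
-/

noncomputable section

open Literature.AnabelianGeometry.EtaleTheta (ContH1 ThetaSetting)
open Literature.AnabelianGeometry.EtaleTheta
open _root_.Topology

namespace Literature.IUT.HodgeArakelov

/-! ### §1. The label-`1` member of the outer family `g ↦ conj_g ∘ e₀ ∘ conj_g⁻¹` is `e₀` -/

namespace CohomologySystemOfContH1

section OneConj

universe u

variable {P : TopGroup.{u}} {G' : Type u} [Group G'] [TopologicalSpace G'] [IsTopologicalGroup G']
  (φ : P →* G') (A : Subgroup G') [A.Normal] [IsMulCommutative A] (H : Subgroup P) [H.Normal]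

/-- Conjugating an automorphism `e₀` of `lim_J H¹(H ∩ J, A)` by the conjugation action of `1 ∈ Π` gives back `e₀`
(`h1LimConj 1 = id`): the label-`1` inversion of abc-iut-w4-d019's outer family `g ↦ conj_g ∘ e₀ ∘ conj_g⁻¹`
(`thetaEnvRecordOuter κ e₀`) IS the pointed inversion action `e₀` ([IUTchII] Prop. 2.2 (i): the family of conjugates of
one inversion). [claim: Mochizuki2012, status: disputed] (IUTchII §2 Prop 2.2 (i), kurims p.66) -/
theorem h1LimConjEquiv_one_conj_outer (e₀ : h1Lim φ A H ⊥ ≃+ h1Lim φ A H ⊥) :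
    ((h1LimConjEquiv φ A H (1 : P)).symm.trans e₀).trans (h1LimConjEquiv φ A H (1 : P)) = e₀ := by
  refine AddEquiv.ext fun x => ?_
  have h1 : ∀ y, h1LimConjEquiv φ A H (1 : P) y = y := fun y => by
    rw [h1LimConjEquiv_apply, h1LimConj_one_apply]
  have h2 : (h1LimConjEquiv φ A H (1 : P)).symm x = x := by rw [AddEquiv.symm_apply_eq, h1]
  rw [AddEquiv.trans_apply, AddEquiv.trans_apply, h2, h1]

end OneConj

end CohomologySystemOfContH1

/-! ### §2. The packaged structure at the genuine record of `modelTate p`, outer family through the pointed pair -/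

namespace EtaleLevels

open CohomologySystemOfContH1 EtaleThetaDataOfSetting TemperedThetaMonoids BadPrimeGaussianMonoids
open Literature.AnabelianGeometry.EtaleTheta.SettingModel
open Literature.AnabelianGeometry.SemiGraphs

section TateRecord

open ModelTateCarriers

variable (p : ℕ) [Fact p.Prime] (l : ℕ+) (hlo : Odd (l : ℕ)) (hlp : (l : ℕ).Prime) (hdvd : 4 * (l : ℕ) ∣ p - 1)
  {Es : Set ℕ+} (τ : (ThetaSetting.modelTate p).CyclotomeTower l Es)

/-- **[IUTchII] Prop. 3.1 (i)(ii) — the PACKAGED `Prop31Statements` AT THE GENUINE `θ_env` RECORD OF THE TATE MODEL,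
print-faithful OUTER inversion family** (`modelTate p`, Galois factor `inr`, class `η̈♯ = etaDdχq`, `X̲̲ := Huuχq` of record,
root cocycle `rootLift`, cyclotome family `τ.modAll` of a tower `τ`, EMPTY cusp labelling, `l` an odd prime with
`4l ∣ p − 1`; inversions = the `Π^tp_{X̲̲}`-conjugates of the transport `e₀ := pairRhoLim …` of the pointed inversion PAIR
`(inversionAlpha C ι hι, ι^Θ)`, `ι := inversionχq`; `Ψ_cns := κ(O)` for abc-iut-w4-d007's Kummer map of a
`Π^tp_{X̲̲}`-stable constant monoid `O ≤ ℚ̄_pˣ`): ALL THREE typed clauses — `conj_permutes` (the conjugation action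
permutes `{Ψ^ι_env}_ι`), `splitting` (`(M^×_TM, ⟨∞θ^ι_env⟩)` is a splitting up to torsion for EVERY `ι`),
`constants_stable` — hold. Assembly: abc-iut-w5-d072's one-label closer of record `splitting_toRecord_padic_of_eval_modelTate`
(label `1`, whose action is `e₀` by `h1LimConjEquiv_one_conj_outer`) + the label transport / packaging
`prop31Statements_thetaEnvRecordOuterKummer_of_splitting_at` (p492714). The record's own inputs (`h15`, `h15ii`, `hι`,
`hf`, `hZ`, `hlim`, `hp2`/`hpl`/`hζ`) are THEOREMS of the tree exactly as in p461404. RESIDUAL (every binder after the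
`let`s): {(H1) `PiYddCharacteristic C` (F-2633 at the instance), the tower `τ` (DATA), `hOst` (`Π^tp_{X̲̲}`-stability of
`O`), the Cor 3.5 (K)/(E) DATA: `c`/`c₀` bijective with `μ ⊆ O` and `c₀ = c` on elements, ONE evaluation section `s₀` with
`hact` and finite-index image, `θ ∈ θ^{1}_env` with `R₀ θ = κ₀ q`, `q` a non-unit}. SEMI-SYNTHETIC MODEL, binder-discharge
evidence only; no side taken on [IUTchIII] Cor. 3.12. [claim: Mochizuki2012, status: disputed] (IUTchII §3 Prop 3.1 (i), kurims p.87) -/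
theorem prop31Statements_thetaEnvRecordOuterKummer_modelTate
    [TopologicalSpace (PadicAlgCl p)ˣ] (O : Submonoid (PadicAlgCl p)ˣ)
    (hOtors : ∀ a : (PadicAlgCl p)ˣ, IsOfFinOrder a → a ∈ O ∧ a⁻¹ ∈ O)
    {P₀ : TopGroup.{0}} (φ₀ : P₀ →* (ThetaSetting.modelTate p).GtpTheta) [MulDistribMulAction P₀ (PadicAlgCl p)ˣ]
    (hA₀ : ∀ b : (PadicAlgCl p)ˣ, IsOpen (MulAction.stabilizer P₀ b : Set P₀))
    (hfi₀ : ∀ b : (PadicAlgCl p)ˣ, (MulAction.stabilizer P₀ b).FiniteIndex) :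
    let hC := compat_modelχq p 1 2 even_two
    let hS := ThetaSetting.modelχq_sec2Hyps p 1 2 even_two
    let K₀ := (kummerCoreχq p 1 2 even_two).toKummerDataOfSection SemidirectProduct.inr (continuous_inrχq p 1 2)
        (fun _ => rfl) (map_inr_GK_le_GtpY_modelχq' p 1 2 even_two) (map_inr_GKdd_le_GtpYdd_modelχq' p 1 2 even_two)
    let E := K₀.etaleThetaDataOfClass (etaDdχq p 1 2 even_two)
    let C := E.doubleUnderlineχqOfEtaRes p 1 2 l hlo (eta_res_etaDdχq p 1 2 even_two l hlo)
    let h15 : ThetaSetting.Prop15iii E hC :=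
      prop15iii_etaleThetaDataOfClass_etaDdχq p hC SemidirectProduct.inr (continuous_inrχq p 1 2) (fun _ => rfl)
        (map_inr_GK_le_GtpY_modelχq' p 1 2 even_two) (map_inr_GKdd_le_GtpYdd_modelχq' p 1 2 even_two)
    let L : C.CuspLabels := ⟨fun _ => ∅, fun _ => ∅, fun _ => rfl⟩
    let hO := ThetaSetting.modelχq_isEtThOrigin p 1 2 even_two
    let hYcl := hYcl_modelχq p 1 2 even_two
    let hp2 := ne_two_of_four_mul_dvd_pred p l.pos hdvd
    let hpl := ne_of_four_mul_dvd_pred p l.pos hdvd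
    let hζ := exists_isPrimitiveRoot_K_modelχq p 1 2 even_two l.pos hdvd
    let hZ : ∀ M : ℕ+, Nonempty (ModelCyclotomes.lDeltaQuot (C.rigidData (τ.modAll M) hC hS h15 L) ≃*
        Literature.IUT.HodgeTheaters.ZHat) := fun M =>
      ModelCyclotomes.nonempty_lDeltaQuot_rigidData_mulEquiv_zHat C (τ.modAll M) hC hS h15 L hO hYcl hlp.ne_zero
    let hlim := bijective_rigidLimHom C hC hS hlp hp2 hpl hζ τ.modAll (EtaleThetaDataOfSetting.rootLift C)
      (rootLift_mem_rootCocycles C hC) τ.red_modAll h15 L hZ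
    let cι : ThetaSetting.ThetaCompanion (Dα := ThetaSetting.modelTate p) (Dβ := ThetaSetting.modelTate p) (inversionχq p 1 2) :=
      (ThetaSetting.modelTate p).thetaCompanionOfAut (inversionχq p 1 2)
        (isInversionAut_inversionχq p 1 2 even_two).map_deltaTemp (hasThetaTopology_modelχq p 1 2 even_two).isQuotientMap_toTheta
    haveI := piYdd_normal C hC
    haveI : ((ThetaSetting.modelTate p).lDeltaTheta l).Normal := ThetaSetting.lDeltaTheta_normal _ l
    haveI : IsMulCommutative ((ThetaSetting.modelTate p).lDeltaTheta l) :=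
      EtaleThetaDataOfSetting.instIsMulCommutative_lDeltaTheta (D := ThetaSetting.modelTate p) l
    letI : MulDistribMulAction (Pi C) (PadicAlgCl p)ˣ := EtaleThetaDataOfSetting.unitsAction C
    ∀ (hcharY : PiYddCharacteristic C),
    let e₀ : h1Lim (phi C) ((ThetaSetting.modelTate p).lDeltaTheta l) (PiYdd C) ⊥ ≃+
        h1Lim (phi C) ((ThetaSetting.modelTate p).lDeltaTheta l) (PiYdd C) ⊥ :=
      pairRhoLim C (inversionAlpha C (inversionχq p 1 2) (map_Huuχq_inversionχq p 1 2 l hlo)) cι.thetaIso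
        (thetaCompanion_phi C (inversionχq p 1 2) (map_Huuχq_inversionχq p 1 2 l hlo) cι)
        (mem_lDeltaTheta_iff_thetaCompanion (D := ThetaSetting.modelTate p) (inversionχq p 1 2) cι l)
        (mem_PiYdd_iff_of_piYddCharacteristic C hcharY _)
    ∀ (s₀ : P₀ →* Pi C) (hs₀ : Continuous ((MonoidHom.id (Pi C)).comp s₀))
      (hN : (⊤ : Subgroup P₀).map ((MonoidHom.id (Pi C)).comp s₀) ≤ PiYdd C)
      (hφ : (phi C).comp ((MonoidHom.id (Pi C)).comp s₀) = φ₀)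
      (c : CyclotomeCoefficients (phi C) ((ThetaSetting.modelTate p).lDeltaTheta l) (PadicAlgCl p)ˣ)
      (hA : ∀ b : (PadicAlgCl p)ˣ, IsOpen (MulAction.stabilizer (Pi C) b : Set (Pi C)))
      (hfi : ∀ b : (PadicAlgCl p)ˣ, (MulAction.stabilizer (Pi C) b).FiniteIndex)
      (_hOst : ∀ (σ : Pi C) (b : (PadicAlgCl p)ˣ), b ∈ O → σ • b ∈ O)
      (c₀ : CyclotomeCoefficients φ₀ ((ThetaSetting.modelTate p).lDeltaTheta l) (PadicAlgCl p)ˣ)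
      (_hc : Function.Bijective c.hom) (_hc₀ : Function.Bijective c₀.hom) (_hc₀c : ∀ ζ, c₀.hom ζ = c.hom ζ)
      (_hact : ∀ (g : P₀) (a : (PadicAlgCl p)ˣ), g • a = s₀ g • a)
      [((EtaleThetaDataOfSetting.aug C).comp s₀).range.FiniteIndex]
      {θ : (thetaEnvRecordOuterKummer C hC hS hlp hp2 hpl hζ τ.modAll (EtaleThetaDataOfSetting.rootLift C)
        (rootLift_mem_rootCocycles C hC) τ.red_modAll h15 L hZ hcharY hlim e₀ c hA hfi O).H}
      (_hθ : θ ∈ (thetaEnvRecordOuterKummer C hC hS hlp hp2 hpl hζ τ.modAll (EtaleThetaDataOfSetting.rootLift C)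
        (rootLift_mem_rootCocycles C hC) τ.red_modAll h15 L hZ hcharY hlim e₀ c hA hfi O).thetaEnv (1 : Pi C))
      (R₀ : (thetaEnvRecordOuterKummer C hC hS hlp hp2 hpl hζ τ.modAll (EtaleThetaDataOfSetting.rootLift C)
          (rootLift_mem_rootCocycles C hC) τ.red_modAll h15 L hZ hcharY hlim e₀ c hA hfi O).H →*
        Multiplicative (h1Lim φ₀ ((ThetaSetting.modelTate p).lDeltaTheta l) (⊤ : Subgroup P₀) ⊥))
      (_hR₀ : ∀ y, Multiplicative.toAdd (R₀ y) =
        h1LimCongr ((ThetaSetting.modelTate p).lDeltaTheta l) ⊤ hφ ⊥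
          (h1LimComap (phi C) ((ThetaSetting.modelTate p).lDeltaTheta l) ((MonoidHom.id (Pi C)).comp s₀) hs₀ hN
            (AddEquiv.additiveMultiplicative (h1Lim (phi C) ((ThetaSetting.modelTate p).lDeltaTheta l) (PiYdd C) ⊥)
              (Additive.ofMul y))))
      (q : O) (_hRθ : R₀ θ = h1LimKummerOn φ₀ ((ThetaSetting.modelTate p).lDeltaTheta l) ⊤ c₀ hA₀ hfi₀ O q)
      (_hq : ¬ IsUnit q),
      TemperedThetaMonoids.Prop31Statements
        (thetaEnvRecordOuterKummer C hC hS hlp hp2 hpl hζ τ.modAll (EtaleThetaDataOfSetting.rootLift C)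
          (rootLift_mem_rootCocycles C hC) τ.red_modAll h15 L hZ hcharY hlim e₀ c hA hfi O) := by
  intro hC hS K₀ E C h15 L hO hYcl hp2 hpl hζ hZ hlim cι hcharY e₀ s₀ hs₀ hN hφ c hA hfi hOst c₀ hc hc₀ hc₀c hact _ θ hθ R₀
    hR₀ q hRθ hq
  haveI := piYdd_normal C hC
  haveI : ((ThetaSetting.modelTate p).lDeltaTheta l).Normal := ThetaSetting.lDeltaTheta_normal _ l
  haveI : IsMulCommutative ((ThetaSetting.modelTate p).lDeltaTheta l) :=
    EtaleThetaDataOfSetting.instIsMulCommutative_lDeltaTheta (D := ThetaSetting.modelTate p) l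
  letI : MulDistribMulAction (Pi C) (PadicAlgCl p)ˣ := EtaleThetaDataOfSetting.unitsAction C
  refine prop31Statements_thetaEnvRecordOuterKummer_of_splitting_at C hC hS hlp hp2 hpl hζ τ.modAll
    (EtaleThetaDataOfSetting.rootLift C) (rootLift_mem_rootCocycles C hC) τ.red_modAll h15 L hZ hcharY hlim e₀ c hA hfi O
    hOst (1 : Pi C) ?_
  have hi₀ : (fun g : Pi C =>
      ((h1LimConjEquiv (phi C) ((ThetaSetting.modelTate p).lDeltaTheta l) (PiYdd C) g).symm.trans e₀).trans
        (h1LimConjEquiv (phi C) ((ThetaSetting.modelTate p).lDeltaTheta l) (PiYdd C) g)) (1 : Pi C) = e₀ :=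
    h1LimConjEquiv_one_conj_outer (phi C) ((ThetaSetting.modelTate p).lDeltaTheta l) (PiYdd C) e₀
  exact (splitting_toRecord_padic_of_eval_modelTate p l hlo hlp hdvd τ hcharY
    (fun g : Pi C =>
      ((h1LimConjEquiv (phi C) ((ThetaSetting.modelTate p).lDeltaTheta l) (PiYdd C) g).symm.trans e₀).trans
        (h1LimConjEquiv (phi C) ((ThetaSetting.modelTate p).lDeltaTheta l) (PiYdd C) g))
    φ₀ s₀ hs₀ hN hφ c hA hfi O c₀ hA₀ hfi₀ hc hOtors hc₀ hc₀c hact hi₀ hθ R₀ hR₀ q hRθ hq).1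

end TateRecord

end EtaleLevels

end Literature.IUT.HodgeArakelov

end
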